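import Mathlib
import Literature.NumberTheory.Transcendental.GammaFields
import Literature.NumberTheory.Transcendental.ZilberGenericClosedness
import Literature.NumberTheory.Transcendental.PseudoExpVariants

/-!
# Crux `AclSubsetLogFreeCore` (stmt-Schanuel-0968), line `eac-extends-core-automorphisms`,
skeleton 46b227c7 — small kernel-checked facts about the DOUBLING INTERFACE
(`stub_doubleBase` / `stub_doubleModel`), drefute gen 4

Two "no-junk / redundancy" facts about the hypotheses of the two unconditional open stubs of the
reshaped line (lead prover-line-stmt-Schanuel-0968-1), recorded for the lead:

* `linIndepOver_of_intFree` — **`hlin` is REDUNDANT in `stub_doubleBase` (and in `doubling`,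
  `hD` of `stub_caseI`)**: the first clause of the freeness hypothesis `hfree`
  ("no non-zero `ℤ`-combination of `e` is algebraic over the Γ-field of `X`") already implies
  `LinIndepOver X e` (clear denominators; `X ⊆ gens X ⊆ acl (gens X)`).  It is NOT redundant in
  `stub_doubleModel`, which does not carry `hfree`.
* `exp_eq_one_of_doubleInterface`, `eq_or_eq_neg_of_doubleInterface` — **the interface of
  `stub_doubleModel` pins the "arbitrary" `τ`**: from `hFW` (the field `F` contains `W` and its
  division points), the standard-kernel partial exponential field `hK`, `hjτ` (`j₁ τ = t`), `hD`
  (`j₁ W ⊆ D`) and `hθ` (`θ ∘ j₁ = j₁ ∘ exp` on `W`) alone, `exp τ = 1` and in fact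
  `τ = 2πi ∨ τ = −2πi`; so the missing `hτ : τ = 2πi` in `stub_doubleModel` admits no junk instance
  (the sign is absorbed by `ℚτ = ℚ(−τ)`).  Paper remark of drefute gen 3 (§7), now kernel-checked.
* `sub_mem_zmultiples_of_doubleInterface` — **the kernel obstruction (R2)**: if the two copies
  agree on `exp x` for some `x ∈ W`, then `j₂ x − j₁ x ∈ ℤt` (standard kernel), so an L-type element
  `Σ qⱼeⱼ` over the forced-agreement field `ℚ(gens X)` kills the general-position clause `hnov`:
  the interface EXCLUDES such inputs (they are not counter-instances of the conclusion).

Nothing here asserts a Theses statement; both are hypothesis-level facts (mutation / no-junk),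
in the sense of the Negative lane.
-/

noncomputable section

set_option linter.dupNamespace false

open Set
open Literature.NumberTheory.Transcendental Literature.NumberTheory.Transcendental.GammaField

namespace Summit.Schanuel.Schanuel.Theorems.AclSubsetLogFreeCore.Negative

/-- **`hlin` is redundant given integral freeness**: if no non-zero `ℤ`-combination of the tuple
`e` lies in `acl (gens X)`, then `e` is `ℚ`-linearly independent over `X`
(`X ⊆ gens X ⊆ acl (gens X)`; clear denominators). [folklore] -/
theorem linIndepOver_of_intFree {F : Type*} [Field F] [CharZero F]
    [Literature.ModelTheory.ExponentialFields.ExponentialRing F]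
    (X : Submodule ℚ F) {k : ℕ} (e : Fin k → F)
    (hfree : ∀ m : Fin k → ℤ, m ≠ 0 → (∑ j, (m j : ℚ) • e j) ∉ acl (gens X)) :
    LinIndepOver X e := by
  classical
  intro q hq
  by_contra hq0
  obtain ⟨j₀, hj₀⟩ : ∃ j, q j ≠ 0 := Function.ne_iff.1 hq0
  -- clear denominators
  set Dz : ℤ := ∏ i, ((q i).den : ℤ) with hDz
  let m : Fin k → ℤ := fun j => (q j).num * ∏ i ∈ Finset.univ.erase j, ((q i).den : ℤ)
  have hm : ∀ j, ((m j : ℤ) : ℚ) = (Dz : ℚ) * q j := by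
    intro j
    have h1 : (Dz : ℚ) = ((q j).den : ℚ) * ∏ i ∈ Finset.univ.erase j, ((q i).den : ℚ) := by
      rw [hDz]; push_cast
      exact (Finset.mul_prod_erase Finset.univ (fun i => ((q i).den : ℚ)) (Finset.mem_univ j)).symm
    have h2 : q j * ((q j).den : ℚ) = (q j).num := Rat.mul_den_eq_num (q j)
    rw [h1]
    simp only [m, Int.cast_mul, Int.cast_prod, Int.cast_natCast]
    rw [← h2]; ring
  have hm0 : m ≠ 0 := by
    intro h
    have hj : m j₀ = 0 := by rw [h]; rfl
    simp only [m, mul_eq_zero, Rat.num_eq_zero, Finset.prod_eq_zero_iff, Finset.mem_erase,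
      Int.natCast_eq_zero] at hj
    rcases hj with hj | ⟨i, -, hi⟩
    · exact hj₀ hj
    · exact (q i).den_nz hi
  have hsum : (∑ j, (m j : ℚ) • e j) = (Dz : ℚ) • ∑ j, q j • e j := by
    rw [Finset.smul_sum]
    refine Finset.sum_congr rfl fun j _ => ?_
    rw [hm j, mul_smul]
  have hmem : (∑ j, (m j : ℚ) • e j) ∈ X := by rw [hsum]; exact X.smul_mem _ hq
  exact hfree m hm0 (subset_acl _ (mem_gens_of_mem hmem))

/-- **The doubling interface forces `exp τ = 1`.**  Hypotheses are those of `stub_doubleModel`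
that are used: `hFW`, `hK`, `hjτ`, `hθ` (only the first copy). [folklore] -/
theorem exp_eq_one_of_doubleInterface (τ : ℂ) {N k : ℕ} (c : Fin N → ℂ) (e : Fin k → ℂ)
    (F : IntermediateField ℚ ℂ)
    (hFW : ∀ x ∈ Submodule.span ℚ ({τ} : Set ℂ) ⊔ Submodule.span ℚ (range (Fin.append c e)),
      x ∈ F ∧ ∀ M : ℕ, Complex.exp (x / (M.factorial : ℂ)) ∈ F)
    (K : Type) [Field K] [CharZero K] (D : Submodule ℚ K) (θ : K → K) (t : K) (j₁ j₂ : F →+* K)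
    (hK : IsStdKernelPartialExpField K D θ t)
    (hjτ : ∀ hτF : τ ∈ F, j₁ ⟨τ, hτF⟩ = t ∧ j₂ ⟨τ, hτF⟩ = t)
    (hθ : ∀ (x : ℂ) (hxF : x ∈ F) (hexF : Complex.exp x ∈ F),
      x ∈ Submodule.span ℚ ({τ} : Set ℂ) ⊔ Submodule.span ℚ (range (Fin.append c e)) →
      θ (j₁ ⟨x, hxF⟩) = j₁ ⟨Complex.exp x, hexF⟩ ∧ θ (j₂ ⟨x, hxF⟩) = j₂ ⟨Complex.exp x, hexF⟩) :
    Complex.exp τ = 1 := by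
  have hτW : τ ∈ Submodule.span ℚ ({τ} : Set ℂ) ⊔ Submodule.span ℚ (range (Fin.append c e)) :=
    Submodule.mem_sup_left (Submodule.subset_span rfl)
  obtain ⟨hτF, hτexp⟩ := hFW τ hτW
  have hexF : Complex.exp τ ∈ F := by simpa using hτexp 0
  have h1 := (hθ τ hτF hexF hτW).1
  rw [(hjτ hτF).1, hK.map_tau] at h1
  have h2 : (⟨Complex.exp τ, hexF⟩ : F) = 1 := j₁.injective (by rw [map_one]; exact h1.symm)
  exact congrArg (fun y : F => (y : ℂ)) h2

/-- **The doubling interface pins `τ = ±2πi`** (no junk `τ` in `stub_doubleModel`): with also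
`hD` (`j₁ W ⊆ D`), the standard kernel `θ x = 1 ↔ x ∈ ℤt` on `D` applied to `x = j₁ (τ/n)`
leaves only `n = ±1` in `τ = n·2πi`. [folklore] -/
theorem eq_or_eq_neg_of_doubleInterface (τ : ℂ) {N k : ℕ} (c : Fin N → ℂ) (e : Fin k → ℂ)
    (F : IntermediateField ℚ ℂ)
    (hFW : ∀ x ∈ Submodule.span ℚ ({τ} : Set ℂ) ⊔ Submodule.span ℚ (range (Fin.append c e)),
      x ∈ F ∧ ∀ M : ℕ, Complex.exp (x / (M.factorial : ℂ)) ∈ F)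
    (K : Type) [Field K] [CharZero K] (D : Submodule ℚ K) (θ : K → K) (t : K) (j₁ j₂ : F →+* K)
    (hK : IsStdKernelPartialExpField K D θ t)
    (hjτ : ∀ hτF : τ ∈ F, j₁ ⟨τ, hτF⟩ = t ∧ j₂ ⟨τ, hτF⟩ = t)
    (hD : D = Submodule.span ℚ
      ((fun x : F => j₁ x) '' {x : F | (x : ℂ) ∈ Submodule.span ℚ ({τ} : Set ℂ) ⊔
          Submodule.span ℚ (range (Fin.append c e))} ∪
        (fun x : F => j₂ x) '' {x : F | (x : ℂ) ∈ Submodule.span ℚ ({τ} : Set ℂ) ⊔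
          Submodule.span ℚ (range (Fin.append c e))}))
    (hθ : ∀ (x : ℂ) (hxF : x ∈ F) (hexF : Complex.exp x ∈ F),
      x ∈ Submodule.span ℚ ({τ} : Set ℂ) ⊔ Submodule.span ℚ (range (Fin.append c e)) →
      θ (j₁ ⟨x, hxF⟩) = j₁ ⟨Complex.exp x, hexF⟩ ∧ θ (j₂ ⟨x, hxF⟩) = j₂ ⟨Complex.exp x, hexF⟩) :
    τ = 2 * Real.pi * Complex.I ∨ τ = -(2 * Real.pi * Complex.I) := by
  set W := Submodule.span ℚ ({τ} : Set ℂ) ⊔ Submodule.span ℚ (range (Fin.append c e)) with hW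
  have hτW : τ ∈ W := Submodule.mem_sup_left (Submodule.subset_span rfl)
  obtain ⟨hτF, -⟩ := hFW τ hτW
  have ht : j₁ ⟨τ, hτF⟩ = t := (hjτ hτF).1
  -- the kernel on `j₁ W`
  have key : ∀ x (hxW : x ∈ W), Complex.exp x = 1 → ∃ m : ℤ, x = m * τ := by
    intro x hxW hx1
    obtain ⟨hxF, hxexp⟩ := hFW x hxW
    have hexF : Complex.exp x ∈ F := by simpa using hxexp 0
    have h1 := (hθ x hxF hexF hxW).1
    have hjD : j₁ ⟨x, hxF⟩ ∈ D := by
      rw [hD]; exact Submodule.subset_span (Or.inl ⟨⟨x, hxF⟩, hxW, rfl⟩)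
    have hθ1 : θ (j₁ ⟨x, hxF⟩) = 1 := by
      rw [h1]
      have : (⟨Complex.exp x, hexF⟩ : F) = 1 := Subtype.ext hx1
      rw [this, map_one]
    obtain ⟨m, hm⟩ := AddSubgroup.mem_zmultiples_iff.1 ((hK.map_eq_one_iff hjD).1 hθ1)
    refine ⟨m, ?_⟩
    rw [← ht, zsmul_eq_mul, ← map_intCast j₁, ← map_mul] at hm
    have h3 := j₁.injective hm
    have h4 := congrArg (fun y : F => (y : ℂ)) h3
    simp only at h4
    push_cast at h4
    exact h4.symm
  -- `exp τ = 1`, so `τ = n • 2πi` with `n ≠ 0`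
  have hexpτ : Complex.exp τ = 1 :=
    exp_eq_one_of_doubleInterface τ c e F hFW K D θ t j₁ j₂ hK hjτ hθ
  obtain ⟨n, hn⟩ := Complex.exp_eq_one_iff.1 hexpτ
  have hτ0 : τ ≠ 0 := by
    intro h0
    apply hK.tau_ne_zero
    rw [← ht]
    have : (⟨τ, hτF⟩ : F) = 0 := Subtype.ext h0
    rw [this, map_zero]
  have hn0 : n ≠ 0 := by rintro rfl; apply hτ0; rw [hn]; simp
  have h2πI : (2 * Real.pi * Complex.I : ℂ) ≠ 0 := by
    have hπ : (Real.pi : ℂ) ≠ 0 := Complex.ofReal_ne_zero.2 Real.pi_ne_zero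
    simp [hπ, Complex.I_ne_zero]
  -- `2πi = (1/n) τ ∈ W`
  have hxW : (2 * Real.pi * Complex.I : ℂ) ∈ W := by
    have hmem : ((n : ℚ)⁻¹ • τ : ℂ) ∈ W := W.smul_mem _ hτW
    have heq : ((n : ℚ)⁻¹ • τ : ℂ) = 2 * Real.pi * Complex.I := by
      rw [hn, Rat.smul_def]
      push_cast
      field_simp
    rwa [heq] at hmem
  obtain ⟨m, hm⟩ := key _ hxW Complex.exp_two_pi_mul_I
  -- `2πi = m n 2πi`, so `m n = 1`
  rw [hn, ← mul_assoc] at hm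
  have hmn : ((m * n : ℤ) : ℂ) = 1 := by
    push_cast
    exact (mul_eq_right₀ h2πI).1 hm.symm
  have hmn' : m * n = 1 := by exact_mod_cast hmn
  rcases Int.eq_one_or_neg_one_of_mul_eq_one' hmn' with ⟨-, rfl⟩ | ⟨-, rfl⟩
  · left; rw [hn]; simp
  · right; rw [hn]; simp

/-- **Kernel obstruction (drefute gen 3 §7 (R2), kernel-checked): an element of `W` whose
exponential the two copies AGREE on is moved by `j₂ − j₁` only inside `ℤt`.**  Under the
interface of `stub_doubleModel` (`hK` standard kernel, `hD`, `hθ`), if `x ∈ W ∩ F`, `exp x ∈ F`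
and `j₁ (exp x) = j₂ (exp x)`, then `j₂ x − j₁ x ∈ ℤt`.  Consequence: for `x = Σ qⱼ eⱼ` with
`exp x` in the forced-agreement field `ℚ(gens X)` (an L-type element over the base) the
general-position clause `hnov` fails — such inputs are excluded by the interface itself, not by
the conclusion. [folklore] -/
theorem sub_mem_zmultiples_of_doubleInterface (τ : ℂ) {N k : ℕ} (c : Fin N → ℂ) (e : Fin k → ℂ)
    (F : IntermediateField ℚ ℂ)
    (K : Type) [Field K] [CharZero K] (D : Submodule ℚ K) (θ : K → K) (t : K) (j₁ j₂ : F →+* K)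
    (hK : IsStdKernelPartialExpField K D θ t)
    (hD : D = Submodule.span ℚ
      ((fun x : F => j₁ x) '' {x : F | (x : ℂ) ∈ Submodule.span ℚ ({τ} : Set ℂ) ⊔
          Submodule.span ℚ (range (Fin.append c e))} ∪
        (fun x : F => j₂ x) '' {x : F | (x : ℂ) ∈ Submodule.span ℚ ({τ} : Set ℂ) ⊔
          Submodule.span ℚ (range (Fin.append c e))}))
    (hθ : ∀ (x : ℂ) (hxF : x ∈ F) (hexF : Complex.exp x ∈ F),
      x ∈ Submodule.span ℚ ({τ} : Set ℂ) ⊔ Submodule.span ℚ (range (Fin.append c e)) →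
      θ (j₁ ⟨x, hxF⟩) = j₁ ⟨Complex.exp x, hexF⟩ ∧ θ (j₂ ⟨x, hxF⟩) = j₂ ⟨Complex.exp x, hexF⟩)
    (x : ℂ) (hxW : x ∈ Submodule.span ℚ ({τ} : Set ℂ) ⊔ Submodule.span ℚ (range (Fin.append c e)))
    (hxF : x ∈ F) (hexF : Complex.exp x ∈ F)
    (hagx : j₁ ⟨Complex.exp x, hexF⟩ = j₂ ⟨Complex.exp x, hexF⟩) :
    j₂ ⟨x, hxF⟩ - j₁ ⟨x, hxF⟩ ∈ AddSubgroup.zmultiples t := by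
  obtain ⟨h1, h2⟩ := hθ x hxF hexF hxW
  have hj₁D : j₁ ⟨x, hxF⟩ ∈ D := by
    rw [hD]; exact Submodule.subset_span (Or.inl ⟨⟨x, hxF⟩, hxW, rfl⟩)
  have hj₂D : j₂ ⟨x, hxF⟩ ∈ D := by
    rw [hD]; exact Submodule.subset_span (Or.inr ⟨⟨x, hxF⟩, hxW, rfl⟩)
  have hdD : j₂ ⟨x, hxF⟩ - j₁ ⟨x, hxF⟩ ∈ D := D.sub_mem hj₂D hj₁D
  have hsplit : j₂ ⟨x, hxF⟩ = (j₂ ⟨x, hxF⟩ - j₁ ⟨x, hxF⟩) + j₁ ⟨x, hxF⟩ := (sub_add_cancel _ _).symm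
  have h3 : θ (j₂ ⟨x, hxF⟩) = θ (j₂ ⟨x, hxF⟩ - j₁ ⟨x, hxF⟩) * θ (j₁ ⟨x, hxF⟩) := by
    conv_lhs => rw [hsplit]
    exact hK.map_add hdD hj₁D
  rw [h2, h1, ← hagx] at h3
  have hne : j₁ ⟨Complex.exp x, hexF⟩ ≠ 0 := by rw [← h1]; exact hK.map_ne_zero hj₁D
  have hθ1 : θ (j₂ ⟨x, hxF⟩ - j₁ ⟨x, hxF⟩) = 1 := (mul_eq_right₀ hne).1 h3.symm
  exact (hK.map_eq_one_iff hdD).1 hθ1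

end Summit.Schanuel.Schanuel.Theorems.AclSubsetLogFreeCore.Negative

end
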